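import Literature.AnabelianGeometry.EtaleTheta.Discharge.Sec2Cor28iIsStandardChiCusp
import Literature.AnabelianGeometry.EtaleTheta.ThetaCoversAutCu
import HarnessLib

/-!
# [EtTh] Cor 2.8 (i) at the cusped inversion model `χ′`, II: the END-KNIT — the body of abc-iut-L2-t2's `Cor28_i` for EVERY
# INNER automorphism `γ_y` (`y ∈ Π^tp_C`) at the SECTION-route cover of record, its own binders internal, residual ∅ (proof-only)

S. Mochizuki, *The étale theta function and its Frobenioid-theoretic manifestations* [EtTh], Publ. RIMS **45** (2009), §2,
Cor 2.8 (i) PRIMS PDF p.42 («`γ` preserves the property that `η̲̈^{Θ,l·ℤ×μ₂}` (resp. `η̈^{Θ,ℤ×μ₂}`; `η̲̈^{Θ,l·ℤ×μ₂}`; `η̈^{Θ,l·ℤ×μ₂}`)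
be of standard type — a property that determines this collection of classes up to multiplication by a root of unity of order `l`
(resp. `1`; `l`; `1`)»; proof: «Theorem 1.10 (i) and the definitions»), Rmk 2.1.1 p.36 («`C̲ → C` fails to be Galois»), Prop 2.4 p.38,
Def 2.7 p.41 (bib key `MochizukiEtTh2009`).

PROOF-ONLY companion (0 `def`, 0 `instance`, no new `Prop`; cell abc-iut, layer L2, seat abc-iut-f-151 gen 7 — block-F tranche 151's
row F-0640 `Cor28_i`; abc-iut-L2-lead R1055/R1119, VNEXT note N-C28I-1; every input BY NAME, nothing restated).  abc-iut-L2-t2's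
`ThetaOrbitData.Cor28_i` = `IsStandard → ∀ Γ Γ_Θ, InducesOnTheta Γ Γ_Θ → (Dtau Γ-stable) → ∀ hY hYuu, C1 ∧ (tower-stable → C2) ∧
([X̲,X,Ÿ]-stable → C3) ∧ ([C̲,X̲,X,Ÿ]-stable → C4)`.  Part I (`Sec2Cor28iIsStandardChiCusp`, this seat) made `IsStandard` a THEOREM
at the χ′ cover of record.  THIS FILE proves the BODY for every INNER `Γ = γ_y`, `y ∈ Π^tp_C`, at abc-iut-L2-d3's section-route cover
`orbitEmbeddingOfHuuOfSection` over abc-iut-w5-d140's `MuTwoSetting.inversionModelχ′` (class `etaDdχ`, `Π^tp_{X̲̲} = Huuχ p l`, slot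
`τ` on a `b`-section), with NOTHING assumed beyond the clause's own binders:
* §1 `TemperedCoverData.mem_tp_PiCu_of_map_innerAutTop_eq` — over the INTERFACE: if `γ_y(Π^tp_{C̲}) = Π^tp_{C̲}` then `y ∈ Π^tp_{C̲}`
  (abc-iut-L6-t23's `normalizer_PiCu_eq` «`N_{Π_C}(Π_{C̲}) = Π_{C̲}`», Rmk 2.1.1, + `toHat_mem_normalizer_PiCu`): the `Π^tp_{C̲}`-entry of
  the stability lists of C2/C4 is what makes abc-iut-w6-d050's junction `exists_mem_dotXuu_pC5_inversionModelχ'` (P-C5 with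
  `σ₀ ∈ Π^tp_{Ẋ̲̲}`, p473918) available — no membership hypothesis on `y` survives;
* §2 **`cor28_i_innerAutTop_endKnit_inversionModelχ'`** — C1 (standard type preserved) and C3 (exact, `κ = 1`) for EVERY `y` by
  abc-iut-w6-d083's model P-C5 `exists_autMap_symm_etaDdχ_eq_conj` (`σ₀ ∈ Π^tp_X`, p443069) and abc-iut-w6-d049's
  `ofEmbedding_transport_outer_etaZMu2` (p436513) + Part I's `IsStandard`; C2/C4 (`κ = 1`) via §1, the junction, abc-iut-w6-d049's
  `ofEmbedding_transport_outer_rootLZMu2` / `…_etaLZMu2` and abc-iut-w6-d051's `stab_Huu_of_map_tp_PiXuu` / `stab_GtpXu_of_map_tp_PiXu`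
  reading the `Π^tp_{X̲̲}` / `Π^tp_{X̲}` stabilities off the clause's own list; automorphism pair / `hXuι` by abc-iut-w6-d049's p453395;
* §3 **`exists_orbitEmbedding_isStandard_cor28_i_innerAutTop_inversionModelχ'`** — binder-free ∃-form at THE cover of record with
  the Def. 1.9 pair `τ^{±1} = tauχ′/tauInvχ′` (`p ≡ 1 (mod 4)`, every odd `l`): `IsStandard` HOLDS ∧ the body holds for every inner
  `γ_y`; and `…_all` — EVERY prime `p`, slots filled by the anchored point `Ü = 1 + p` (HONEST LABEL: slot filling).
WHAT IS NOT CLAIMED: `Cor28_i` AS TYPED quantifies over ALL topological automorphisms `Γ` of `Π^tp_C`; non-inner `Γ` of this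
semi-synthetic `Π^tp_C` are uncontrolled (print's control: Props 2.4/2.6, Thm 1.10 BY NAME) — the universal closure over the
interface is refuted anyway (abc-iut-w4-d051's `not_forall_cor28_i`).  HONEST FRAMING: semi-synthetic model = consistency /
non-vacuity evidence for the TYPED interface only; [EtTh] is refereed and nothing of it is asserted; no side is taken on
[IUTchIII] Cor 3.12; typed ≠ proved; instantiated ≠ endorsed.
-/

noncomputable section

namespace Literature.AnabelianGeometry.EtaleTheta

open Literature.AnabelianGeometry.SemiGraphs ThetaCovers Literature.IUT.HodgeArakelov
open _root_.Topology _root_.Function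
open ThetaSetting.EtaleThetaData.DoubleUnderline.OrbitEmbedding (symm_toTheta_eq)

/-! ## §1. A stability binder of `Cor28_i` for an inner `γ_y` forces `y ∈ Π^tp_{C̲}` (Rmk 2.1.1: `N(Π_{C̲}) = Π_{C̲}`) -/

namespace ThetaCovers.TemperedCoverData

universe u

/-- **`γ_y(Π^tp_{C̲}) = Π^tp_{C̲}` forces `y ∈ Π^tp_{C̲}`** for an inner `γ_y` of `Π^tp_C` — the `Π^tp_{C̲}`-entry of the
stability lists of `Cor28_i`'s clauses (`∀ S ∈ T.tower, γ S = S`, `∀ S ∈ [Π^tp_{C̲}, …], γ S = S`): `Π_{C̲}` is self-normalising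
in `Π_C` (abc-iut-L6-t23's `normalizer_PiCu_eq`, Rmk 2.1.1) and normalising transfers along `Π^tp_C ↪ Π_C`
(`toHat_mem_normalizer_PiCu`). [cite: MochizukiEtTh2009, Rmk 2.1.1 p.36] -/
theorem mem_tp_PiCu_of_map_innerAutTop_eq {l : ℕ} (T : TemperedCoverData.{u} l) {y : T.Gtp}
    (h : (T.tp T.PiCu).map (ThetaOrbitData.innerAutTop y).toMulEquiv.toMonoidHom = T.tp T.PiCu) :
    y ∈ T.tp T.PiCu := by
  have hy : y ∈ Subgroup.normalizer ((T.tp T.PiCu : Subgroup T.Gtp) : Set T.Gtp) :=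
    Subgroup.mem_normalizer_iff.2 fun x =>
      ThetaSetting.EtaleThetaData.DoubleUnderline.OrbitEmbedding.conj_mem_iff_of_map_eq h x
  have := T.toHat_mem_normalizer_PiCu hy
  rw [T.normalizer_PiCu_eq] at this
  exact this

end ThetaCovers.TemperedCoverData

namespace SettingModel

variable (p : ℕ) [Fact p.Prime]

/-! ## §2. The END-KNIT: the body of `Cor28_i` for every INNER `γ_y`, `y ∈ Π^tp_C`, at the section-route cover over `χ′` -/

section EndKnit

variable {PC : Type} [Group PC] [TopologicalSpace PC] [IsTopologicalGroup PC] [T2Space PC]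
variable (e : (MuTwoSetting.inversionModelχ' p).CLevelData)
  (ιC : (MuTwoSetting.inversionModelχ' p).GtpC →ₜ* PC) (hιC : IsProfiniteCompletion ιC)
  (hinj : Function.Injective ιC) (op : (MuTwoSetting.inversionModelχ' p).toThetaSetting.OncePuncturedData)
  {l : ℕ+} (hodd : Odd ((l : ℕ+) : ℕ))
  (s : ↥(MuTwoSetting.inversionModelχ' p).GK →* (MuTwoSetting.inversionModelχ' p).PiTemp)
  (hsa : ∀ σ, (MuTwoSetting.inversionModelχ' p).aug (s σ) = (σ : GQp p))
  (hsZ : ∀ σ, (MuTwoSetting.inversionModelχ' p).toZ (s σ) = 1)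
  (hιell : ∀ c ∈ (e.piCDataOf ιC hιC).augGK.ker, c ∉ (e.piCDataOf ιC hιC).PiX →
    ∀ d ∈ (e.piCDataOf ιC hιC).PiX ⊓ (e.piCDataOf ιC hιC).augGK.ker,
      c * d * c⁻¹ * d ∈ (e.piCDataOf ιC hιC).barTheta l)
  (hN : (((MuTwoSetting.inversionModelχ' p).GtpXu l).map (MuTwoSetting.inversionModelχ' p).inclX).Normal)
  (hY : ((MuTwoSetting.inversionModelχ' p).GtpY.map (MuTwoSetting.inversionModelχ' p).inclX).Normal)
  {E : (MuTwoSetting.inversionModelχ' p).toThetaSetting.EtaleThetaData} (hE : E.etaDd = etaDdχ p)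
  (C : E.DoubleUnderline (l : ℕ)) (hC : C.Huu = Huuχ p l)
  (hK : (MuTwoSetting.inversionModelχ' p).barKerTp l ≤ C.Huu) (hsH : ∀ σ, s σ ∈ C.Huu)
  (hι : C.IotaStable (e.conjX (epsPMInvχ p)))
  (τ τ' : ThetaSetting.NonCuspidalPoint E.toKummerData)

include hE hC

/-- **[EtTh] Cor 2.8 (i): the BODY of abc-iut-L2-t2's `ThetaOrbitData.Cor28_i` for every INNER automorphism `γ_y`,
`y ∈ Π^tp_C`, at `ofEmbedding (orbitEmbeddingOfHuuOfSection …)` over the cusped inversion model `χ′`** (class `η̈^Θ = etaDdχ`,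
`Π^tp_{X̲̲} = Huuχ p l`, a Def-1.9 slot `τ` with `D_τ ≤ s_u(G_K̈)`), its own binders (`Γ_Θ`+`InducesOnTheta`, `hY`, `hYuu`, the
clause-wise stability lists) internal and NOTHING else assumed: (C1) `γ_y` preserves «of standard type» for `η̈^{Θ,ℤ×μ₂}`;
(C2) under `T.tower`-stability `η̲̈^{Θ,l·ℤ×μ₂}` agrees with its transport up to `μ_l` (indeed exactly); (C3) under
`[Π^tp_{X̲}, Π^tp_X, Π^tp_Ÿ]`-stability `η̈^{Θ,ℤ×μ₂}` is determined exactly; (C4) under `[Π^tp_{C̲}, Π^tp_{X̲}, Π^tp_X, Π^tp_Ÿ]`-stability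
`η̈^{Θ,l·ℤ×μ₂}` is determined exactly.  Inputs BY NAME: `IsStandard` = §2 (a THEOREM here, not a binder); P-C5 for EVERY `y`
with `σ₀ ∈ Π^tp_X` = abc-iut-w6-d083's `exists_autMap_symm_etaDdχ_eq_conj` (enough for C1/C3, abc-iut-w6-d049's
`ofEmbedding_transport_outer_etaZMu2`); for C2/C4 the `Π^tp_{C̲}`-entry of the clause's own stability list gives `y ∈ Π^tp_{C̲}` (§3),
whence abc-iut-w6-d050's junction `exists_mem_dotXuu_pC5_inversionModelχ'` (`σ₀ ∈ Π^tp_{Ẋ̲̲}`) and abc-iut-w6-d049's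
`ofEmbedding_transport_outer_rootLZMu2` / `…_etaLZMu2` with the `Π^tp_{X̲̲}` / `Π^tp_{X̲}` stabilities read off the same lists
(abc-iut-w6-d051's `stab_Huu_of_map_tp_PiXuu`, `stab_GtpXu_of_map_tp_PiXu`).  Residual = the constructor's data binders displayed
in the signature (as in p473918 / p491003), nothing else. [cite: MochizukiEtTh2009, Cor 2.8(i) p.42] -/
theorem cor28_i_innerAutTop_endKnit_inversionModelχ' (u : (↥(ThetaSetting.modelχ p).Kdd)ˣ)
    (hτ : τ.Dpt ≤ (ThetaSetting.modelχ p).GKdd.map (sectionOfUnitχ p u))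
    (y : (e.temperedCoverDataOfHuuOfSection ιC hιC hinj op hodd s hsa hsZ hιell hN hY C hK hsH
      (epsPMInvχ_not_mem_range p) hι).Gtp)
    (ΓΘ : (ThetaOrbitData.ofEmbedding
        (e.orbitEmbeddingOfHuuOfSection ιC hιC hinj op hodd s hsa hsZ hιell hN hY C hK hsH (epsPMInvχ_not_mem_range p) hι τ τ')
        (MuTwoSetting.inversionModelχ'_compat p) (ThetaSetting.modelχ'_sec2Hyps p)).DeltaTheta ≃*
      (ThetaOrbitData.ofEmbedding
        (e.orbitEmbeddingOfHuuOfSection ιC hιC hinj op hodd s hsa hsZ hιell hN hY C hK hsH (epsPMInvχ_not_mem_range p) hι τ τ')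
        (MuTwoSetting.inversionModelχ'_compat p) (ThetaSetting.modelχ'_sec2Hyps p)).DeltaTheta)
    (hind : (ThetaOrbitData.ofEmbedding
        (e.orbitEmbeddingOfHuuOfSection ιC hιC hinj op hodd s hsa hsZ hιell hN hY C hK hsH (epsPMInvχ_not_mem_range p) hι τ τ')
        (MuTwoSetting.inversionModelχ'_compat p) (ThetaSetting.modelχ'_sec2Hyps p)).InducesOnTheta
      (ThetaOrbitData.innerAutTop y) ΓΘ)
    (hYmap : (e.temperedCoverDataOfHuuOfSection ιC hιC hinj op hodd s hsa hsZ hιell hN hY C hK hsH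
          (epsPMInvχ_not_mem_range p) hι).PiYddtp.map (ThetaOrbitData.innerAutTop y).toMulEquiv.toMonoidHom =
      (e.temperedCoverDataOfHuuOfSection ιC hιC hinj op hodd s hsa hsZ hιell hN hY C hK hsH
        (epsPMInvχ_not_mem_range p) hι).PiYddtp)
    (hYuu : ((e.temperedCoverDataOfHuuOfSection ιC hιC hinj op hodd s hsa hsZ hιell hN hY C hK hsH
            (epsPMInvχ_not_mem_range p) hι).PiYddtp ⊓
          (e.temperedCoverDataOfHuuOfSection ιC hιC hinj op hodd s hsa hsZ hιell hN hY C hK hsH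
              (epsPMInvχ_not_mem_range p) hι).tp
            (e.temperedCoverDataOfHuuOfSection ιC hιC hinj op hodd s hsa hsZ hιell hN hY C hK hsH
              (epsPMInvχ_not_mem_range p) hι).PiXuu).map
        (ThetaOrbitData.innerAutTop y).toMulEquiv.toMonoidHom =
      (e.temperedCoverDataOfHuuOfSection ιC hιC hinj op hodd s hsa hsZ hιell hN hY C hK hsH
          (epsPMInvχ_not_mem_range p) hι).PiYddtp ⊓
        (e.temperedCoverDataOfHuuOfSection ιC hιC hinj op hodd s hsa hsZ hιell hN hY C hK hsH
            (epsPMInvχ_not_mem_range p) hι).tp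
          (e.temperedCoverDataOfHuuOfSection ιC hιC hinj op hodd s hsa hsZ hιell hN hY C hK hsH
            (epsPMInvχ_not_mem_range p) hι).PiXuu) :
    -- (C1) "`γ` preserves the property … of standard type"
    (ThetaOrbitData.ofEmbedding
        (e.orbitEmbeddingOfHuuOfSection ιC hιC hinj op hodd s hsa hsZ hιell hN hY C hK hsH (epsPMInvχ_not_mem_range p) hι τ τ')
        (MuTwoSetting.inversionModelχ'_compat p) (ThetaSetting.modelχ'_sec2Hyps p)).IsStandardColl
      ((ThetaOrbitData.ofEmbedding
          (e.orbitEmbeddingOfHuuOfSection ιC hιC hinj op hodd s hsa hsZ hιell hN hY C hK hsH (epsPMInvχ_not_mem_range p)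
            hι τ τ') (MuTwoSetting.inversionModelχ'_compat p) (ThetaSetting.modelχ'_sec2Hyps p)).transport _
        (ThetaOrbitData.innerAutTop y) hYmap ΓΘ
        (ThetaOrbitData.ofEmbedding
          (e.orbitEmbeddingOfHuuOfSection ιC hιC hinj op hodd s hsa hsZ hιell hN hY C hK hsH (epsPMInvχ_not_mem_range p)
            hι τ τ') (MuTwoSetting.inversionModelχ'_compat p) (ThetaSetting.modelχ'_sec2Hyps p)).etaZMu2) ∧
    -- (C2) `γ` on `Π^tp_{X̲̲}` / `Π^tp_{C̲̲}`: `η̲̈^{Θ,l·ℤ×μ₂}`, order `l`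
    ((∀ S ∈ (e.temperedCoverDataOfHuuOfSection ιC hιC hinj op hodd s hsa hsZ hιell hN hY C hK hsH
          (epsPMInvχ_not_mem_range p) hι).tower, S.map (ThetaOrbitData.innerAutTop y).toMulEquiv.toMonoidHom = S) →
      (ThetaOrbitData.ofEmbedding
          (e.orbitEmbeddingOfHuuOfSection ιC hιC hinj op hodd s hsa hsZ hιell hN hY C hK hsH (epsPMInvχ_not_mem_range p)
            hι τ τ') (MuTwoSetting.inversionModelχ'_compat p) (ThetaSetting.modelχ'_sec2Hyps p)).EqUpToRootOfUnity l _
        (ThetaOrbitData.ofEmbedding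
          (e.orbitEmbeddingOfHuuOfSection ιC hιC hinj op hodd s hsa hsZ hιell hN hY C hK hsH (epsPMInvχ_not_mem_range p)
            hι τ τ') (MuTwoSetting.inversionModelχ'_compat p) (ThetaSetting.modelχ'_sec2Hyps p)).rootLZMu2
        ((ThetaOrbitData.ofEmbedding
            (e.orbitEmbeddingOfHuuOfSection ιC hιC hinj op hodd s hsa hsZ hιell hN hY C hK hsH (epsPMInvχ_not_mem_range p)
              hι τ τ') (MuTwoSetting.inversionModelχ'_compat p) (ThetaSetting.modelχ'_sec2Hyps p)).transport _
          (ThetaOrbitData.innerAutTop y) hYuu ΓΘ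
          (ThetaOrbitData.ofEmbedding
            (e.orbitEmbeddingOfHuuOfSection ιC hιC hinj op hodd s hsa hsZ hιell hN hY C hK hsH (epsPMInvχ_not_mem_range p)
              hι τ τ') (MuTwoSetting.inversionModelχ'_compat p) (ThetaSetting.modelχ'_sec2Hyps p)).rootLZMu2)) ∧
    -- (C3) `γ` on `Π^tp_{X̲}`: `η̈^{Θ,ℤ×μ₂}`, order `1`
    ((∀ S ∈ [(e.temperedCoverDataOfHuuOfSection ιC hιC hinj op hodd s hsa hsZ hιell hN hY C hK hsH
            (epsPMInvχ_not_mem_range p) hι).tp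
          (e.temperedCoverDataOfHuuOfSection ιC hιC hinj op hodd s hsa hsZ hιell hN hY C hK hsH
            (epsPMInvχ_not_mem_range p) hι).PiXu,
        (e.temperedCoverDataOfHuuOfSection ιC hιC hinj op hodd s hsa hsZ hιell hN hY C hK hsH
            (epsPMInvχ_not_mem_range p) hι).tp
          (e.temperedCoverDataOfHuuOfSection ιC hιC hinj op hodd s hsa hsZ hιell hN hY C hK hsH
            (epsPMInvχ_not_mem_range p) hι).PiX,
        (e.temperedCoverDataOfHuuOfSection ιC hιC hinj op hodd s hsa hsZ hιell hN hY C hK hsH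
            (epsPMInvχ_not_mem_range p) hι).PiYddtp],
          S.map (ThetaOrbitData.innerAutTop y).toMulEquiv.toMonoidHom = S) →
      (ThetaOrbitData.ofEmbedding
          (e.orbitEmbeddingOfHuuOfSection ιC hιC hinj op hodd s hsa hsZ hιell hN hY C hK hsH (epsPMInvχ_not_mem_range p)
            hι τ τ') (MuTwoSetting.inversionModelχ'_compat p) (ThetaSetting.modelχ'_sec2Hyps p)).EqUpToRootOfUnity 1 _
        (ThetaOrbitData.ofEmbedding
          (e.orbitEmbeddingOfHuuOfSection ιC hιC hinj op hodd s hsa hsZ hιell hN hY C hK hsH (epsPMInvχ_not_mem_range p)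
            hι τ τ') (MuTwoSetting.inversionModelχ'_compat p) (ThetaSetting.modelχ'_sec2Hyps p)).etaZMu2
        ((ThetaOrbitData.ofEmbedding
            (e.orbitEmbeddingOfHuuOfSection ιC hιC hinj op hodd s hsa hsZ hιell hN hY C hK hsH (epsPMInvχ_not_mem_range p)
              hι τ τ') (MuTwoSetting.inversionModelχ'_compat p) (ThetaSetting.modelχ'_sec2Hyps p)).transport _
          (ThetaOrbitData.innerAutTop y) hYmap ΓΘ
          (ThetaOrbitData.ofEmbedding
            (e.orbitEmbeddingOfHuuOfSection ιC hιC hinj op hodd s hsa hsZ hιell hN hY C hK hsH (epsPMInvχ_not_mem_range p)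
              hι τ τ') (MuTwoSetting.inversionModelχ'_compat p) (ThetaSetting.modelχ'_sec2Hyps p)).etaZMu2)) ∧
    -- (C4) `γ` on `Π^tp_{C̲}`: `η̈^{Θ,l·ℤ×μ₂}`, order `1`
    ((∀ S ∈ [(e.temperedCoverDataOfHuuOfSection ιC hιC hinj op hodd s hsa hsZ hιell hN hY C hK hsH
            (epsPMInvχ_not_mem_range p) hι).tp
          (e.temperedCoverDataOfHuuOfSection ιC hιC hinj op hodd s hsa hsZ hιell hN hY C hK hsH
            (epsPMInvχ_not_mem_range p) hι).PiCu,
        (e.temperedCoverDataOfHuuOfSection ιC hιC hinj op hodd s hsa hsZ hιell hN hY C hK hsH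
            (epsPMInvχ_not_mem_range p) hι).tp
          (e.temperedCoverDataOfHuuOfSection ιC hιC hinj op hodd s hsa hsZ hιell hN hY C hK hsH
            (epsPMInvχ_not_mem_range p) hι).PiXu,
        (e.temperedCoverDataOfHuuOfSection ιC hιC hinj op hodd s hsa hsZ hιell hN hY C hK hsH
            (epsPMInvχ_not_mem_range p) hι).tp
          (e.temperedCoverDataOfHuuOfSection ιC hιC hinj op hodd s hsa hsZ hιell hN hY C hK hsH
            (epsPMInvχ_not_mem_range p) hι).PiX,
        (e.temperedCoverDataOfHuuOfSection ιC hιC hinj op hodd s hsa hsZ hιell hN hY C hK hsH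
            (epsPMInvχ_not_mem_range p) hι).PiYddtp],
          S.map (ThetaOrbitData.innerAutTop y).toMulEquiv.toMonoidHom = S) →
      (ThetaOrbitData.ofEmbedding
          (e.orbitEmbeddingOfHuuOfSection ιC hιC hinj op hodd s hsa hsZ hιell hN hY C hK hsH (epsPMInvχ_not_mem_range p)
            hι τ τ') (MuTwoSetting.inversionModelχ'_compat p) (ThetaSetting.modelχ'_sec2Hyps p)).EqUpToRootOfUnity 1 _
        (ThetaOrbitData.ofEmbedding
          (e.orbitEmbeddingOfHuuOfSection ιC hιC hinj op hodd s hsa hsZ hιell hN hY C hK hsH (epsPMInvχ_not_mem_range p)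
            hι τ τ') (MuTwoSetting.inversionModelχ'_compat p) (ThetaSetting.modelχ'_sec2Hyps p)).etaLZMu2
        ((ThetaOrbitData.ofEmbedding
            (e.orbitEmbeddingOfHuuOfSection ιC hιC hinj op hodd s hsa hsZ hιell hN hY C hK hsH (epsPMInvχ_not_mem_range p)
              hι τ τ') (MuTwoSetting.inversionModelχ'_compat p) (ThetaSetting.modelχ'_sec2Hyps p)).transport _
          (ThetaOrbitData.innerAutTop y) hYmap ΓΘ
          (ThetaOrbitData.ofEmbedding
            (e.orbitEmbeddingOfHuuOfSection ιC hιC hinj op hodd s hsa hsZ hιell hN hY C hK hsH (epsPMInvχ_not_mem_range p)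
              hι τ τ') (MuTwoSetting.inversionModelχ'_compat p) (ThetaSetting.modelχ'_sec2Hyps p)).etaLZMu2)) := by
  haveI := (MuTwoSetting.inversionModelχ'_compat p).GtpYdd_normal
  have hqm := isQuotientMap_toTheta_inversionModelχ' p
  -- the automorphism pair of `y` through `ι = inclX`
  have hα : ∀ σ, (e.orbitEmbeddingOfHuuOfSection ιC hιC hinj op hodd s hsa hsZ hιell hN hY C hK hsH (epsPMInvχ_not_mem_range p)
      hι τ τ').ι (e.conjX y σ) =
      y * (e.orbitEmbeddingOfHuuOfSection ιC hιC hinj op hodd s hsa hsZ hιell hN hY C hK hsH (epsPMInvχ_not_mem_range p)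
      hι τ τ').ι σ * y⁻¹ := fun σ =>
    e.orbitEmbeddingOfHuuOfSection_ι_conjX ιC hιC hinj op hodd s hsa hsZ hιell hN hY C hK hsH (epsPMInvχ_not_mem_range p)
      hι τ τ' y σ
  have hβ := e.orbitEmbeddingOfHuu_topCompanion_toTheta hqm y
  obtain ⟨hΔ, hΔ'⟩ := (e.orbitEmbeddingOfHuuOfSection ιC hιC hinj op hodd s hsa hsZ hιell hN hY C hK hsH (epsPMInvχ_not_mem_range p)
      hι τ τ').stab_DeltaTheta_of_induces (MuTwoSetting.inversionModelχ'_compat p)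
    (ThetaSetting.modelχ'_sec2Hyps p) hα hβ hind
  obtain ⟨hYs, hYs'⟩ := (e.orbitEmbeddingOfHuuOfSection ιC hιC hinj op hodd s hsa hsZ hιell hN hY C hK hsH (epsPMInvχ_not_mem_range p)
      hι τ τ').stab_GtpYdd_of_map_PiYddtp hα hYmap
  have hXuι := e.orbitEmbeddingOfHuuOfSection_map_GtpXu ιC hιC hinj op hodd s hsa hsZ hιell hN hY C hK hsH
    (epsPMInvχ_not_mem_range p) hι τ τ'
  -- `IsStandard` is a theorem (§2)
  have hstd := isStandard_ofEmbedding_orbitEmbeddingOfHuuOfSection_of_Dpt_le_sectionOfUnitχ p e ιC hιC hinj op hodd s hsa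
    hsZ hιell hN hY hE C hK hsH τ τ' (MuTwoSetting.inversionModelχ'_compat p) (ThetaSetting.modelχ'_sec2Hyps p)
    (epsPMInvχ_not_mem_range p) hι u hτ
  -- P-C5 for EVERY `y` with `σ₀ ∈ Π^tp_X` (abc-iut-w6-d083)
  obtain ⟨σ₀, -, hP⟩ := exists_autMap_symm_etaDdχ_eq_conj p (ThetaSetting.modelχ p).compat y (e.conjX y) _
    (fun g => e.inclX_conjX _ g) hβ hΔ' hYs
  have hη : ContH1Aut.autMap (MuTwoSetting.inversionModelχ' p).toTheta
        (MuTwoSetting.inversionModelχ' p).toThetaSetting.DeltaTheta (e.conjX y).symm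
        (Thm16Sub.topCompanion (MuTwoSetting.inversionModelχ' p).toThetaSetting
          (MuTwoSetting.inversionModelχ' p).toThetaSetting (e.conjX y) (e.map_deltaTemp_conjX y) hqm hqm).symm
        (symm_toTheta_eq hβ) hΔ' (H := (MuTwoSetting.inversionModelχ' p).toThetaSetting.GtpYdd)
        (H' := (MuTwoSetting.inversionModelχ' p).toThetaSetting.GtpYdd) hYs E.etaDd =
      ContH1.conj (MuTwoSetting.inversionModelχ' p).toTheta (MuTwoSetting.inversionModelχ' p).toThetaSetting.DeltaTheta
        σ₀ E.etaDd := by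
    rw [hE]; exact hP
  -- the whole orbit `η̈^{Θ,ℤ×μ₂}` is stable (C1, C3)
  have hZMu2 := (e.orbitEmbeddingOfHuuOfSection ιC hιC hinj op hodd s hsa hsZ hιell hN hY C hK hsH (epsPMInvχ_not_mem_range p)
      hι τ τ').ofEmbedding_transport_outer_etaZMu2 (MuTwoSetting.inversionModelχ'_compat p)
    (ThetaSetting.modelχ'_sec2Hyps p) hα hβ hΔ hΔ' hYs hYs' ΓΘ hind hYmap hη
  refine ⟨by rw [hZMu2]; exact hstd, fun htw => ?_, fun _ => by rw [hZMu2]; exact ThetaOrbitData.eqUpToRootOfUnity_refl _ _ _ _,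
    fun h4 => ?_⟩
  · -- (C2): tower stability ⊇ stability of `Π^tp_{X̲̲}` and of `Π^tp_{C̲}`; the latter puts `y` in `Π^tp_{C̲}` (§3)
    have hXuumap := htw ((e.temperedCoverDataOfHuuOfSection ιC hιC hinj op hodd s hsa hsZ hιell hN hY C hK hsH (epsPMInvχ_not_mem_range p) hι).tp
      (e.temperedCoverDataOfHuuOfSection ιC hιC hinj op hodd s hsa hsZ hιell hN hY C hK hsH (epsPMInvχ_not_mem_range p) hι).PiXuu) (by simp [ThetaCovers.TemperedCoverData.tower])
    have hCumap := htw
      ((e.temperedCoverDataOfHuuOfSection ιC hιC hinj op hodd s hsa hsZ hιell hN hY C hK hsH (epsPMInvχ_not_mem_range p) hι).tp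
        (e.temperedCoverDataOfHuuOfSection ιC hιC hinj op hodd s hsa hsZ hιell hN hY C hK hsH (epsPMInvχ_not_mem_range p)
          hι).PiCu)
      (by simp [ThetaCovers.TemperedCoverData.tower])
    have hyCu := ThetaCovers.TemperedCoverData.mem_tp_PiCu_of_map_innerAutTop_eq _ hCumap
    obtain ⟨hU, hU'⟩ := (e.orbitEmbeddingOfHuuOfSection ιC hιC hinj op hodd s hsa hsZ hιell hN hY C hK hsH (epsPMInvχ_not_mem_range p)
      hι τ τ').stab_Huu_of_map_tp_PiXuu hα hXuumap
    obtain ⟨σ, hσ, hησ⟩ := exists_mem_dotXuu_pC5_inversionModelχ' p e ιC hιC hinj op hodd s hsa hsZ hιell hN hY hE C hC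
      hK hsH hι τ τ' y hyCu
    rw [(e.orbitEmbeddingOfHuuOfSection ιC hιC hinj op hodd s hsa hsZ hιell hN hY C hK hsH (epsPMInvχ_not_mem_range p)
      hι τ τ').ofEmbedding_transport_outer_rootLZMu2 (MuTwoSetting.inversionModelχ'_compat p) (ThetaSetting.modelχ'_sec2Hyps p)
      hα hβ hΔ hΔ' hYs hYs' hU hU' ΓΘ hind hYuu hσ.1 (hησ hΔ' hYs)]
    exact ThetaOrbitData.eqUpToRootOfUnity_refl _ _ _ _
  · -- (C4): the list's `Π^tp_{C̲}`-entry puts `y` in `Π^tp_{C̲}` (§3); its `Π^tp_{X̲}`-entry gives the `Π^tp_{X̲}`-stabilities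
    have hCumap := h4 ((e.temperedCoverDataOfHuuOfSection ιC hιC hinj op hodd s hsa hsZ hιell hN hY C hK hsH (epsPMInvχ_not_mem_range p) hι).tp
      (e.temperedCoverDataOfHuuOfSection ιC hιC hinj op hodd s hsa hsZ hιell hN hY C hK hsH (epsPMInvχ_not_mem_range p) hι).PiCu) (by simp)
    have hXumap := h4
      ((e.temperedCoverDataOfHuuOfSection ιC hιC hinj op hodd s hsa hsZ hιell hN hY C hK hsH (epsPMInvχ_not_mem_range p) hι).tp
        (e.temperedCoverDataOfHuuOfSection ιC hιC hinj op hodd s hsa hsZ hιell hN hY C hK hsH (epsPMInvχ_not_mem_range p)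
          hι).PiXu)
      (by simp)
    have hyCu := ThetaCovers.TemperedCoverData.mem_tp_PiCu_of_map_innerAutTop_eq _ hCumap
    obtain ⟨hXu, hXu'⟩ := (e.orbitEmbeddingOfHuuOfSection ιC hιC hinj op hodd s hsa hsZ hιell hN hY C hK hsH (epsPMInvχ_not_mem_range p)
      hι τ τ').stab_GtpXu_of_map_tp_PiXu hXuι hα hXumap
    obtain ⟨σ, hσ, hησ⟩ := exists_mem_dotXuu_pC5_inversionModelχ' p e ιC hιC hinj op hodd s hsa hsZ hιell hN hY hE C hC
      hK hsH hι τ τ' y hyCu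
    rw [(e.orbitEmbeddingOfHuuOfSection ιC hιC hinj op hodd s hsa hsZ hιell hN hY C hK hsH (epsPMInvχ_not_mem_range p)
      hι τ τ').ofEmbedding_transport_outer_etaLZMu2 (MuTwoSetting.inversionModelχ'_compat p) (ThetaSetting.modelχ'_sec2Hyps p)
      hα hβ hΔ hΔ' hYs hYs' hXu hXu' ΓΘ hind hYmap (C.Huu_le_GtpXu hσ.1) (hησ hΔ' hYs)]
    exact ThetaOrbitData.eqUpToRootOfUnity_refl _ _ _ _

end EndKnit

/-! ## §3. Binder-free ∃-forms at THE cover of record -/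

/-- **Binder-free ∃-form** (`p ≡ 1 (mod 4)`, every odd `l`): there are a `TemperedCoverData` `T` ON `Π^tp_C(inversionModelχ′)`
and an orbit embedding `ε` of abc-iut-L2-t10's `doubleUnderlineχ'Sec` whose points ARE the Def. 1.9 pair `τ^{±1}` such that, for
abc-iut-L2-t2's orbit data `ThetaOrbitData.ofEmbedding ε`, the standing hypothesis `IsStandard` of `Cor28_i` HOLDS and the
body of `Cor28_i` HOLDS for every inner `γ_y`, `y ∈ Π^tp_C` (the universal closure of `Cor28_i` over the interface is refuted,
abc-iut-w4-d051's `not_forall_cor28_i` — instance form only). [cite: MochizukiEtTh2009, Cor 2.8(i) p.42] -/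
theorem exists_orbitEmbedding_isStandard_cor28_i_innerAutTop_inversionModelχ' (hp : p % 4 = 1) (l : ℕ+)
    (hodd : Odd ((l : ℕ+) : ℕ)) :
    ∃ (T : TemperedCoverData.{0} l) (ε : (doubleUnderlineχ'Sec p l hodd).OrbitEmbedding T),
      T.Gtp = (MuTwoSetting.inversionModelχ' p).GtpC ∧ ε.tau = (tauχ' p hp).toNonCuspidalPoint ∧
      ε.tauInv = (tauInvχ' p hp).toNonCuspidalPoint ∧
      (ThetaOrbitData.ofEmbedding ε (MuTwoSetting.inversionModelχ'_compat p) (ThetaSetting.modelχ'_sec2Hyps p)).IsStandard ∧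
      ∀ (y : T.Gtp)
        (ΓΘ : (ThetaOrbitData.ofEmbedding ε (MuTwoSetting.inversionModelχ'_compat p)
            (ThetaSetting.modelχ'_sec2Hyps p)).DeltaTheta ≃*
          (ThetaOrbitData.ofEmbedding ε (MuTwoSetting.inversionModelχ'_compat p) (ThetaSetting.modelχ'_sec2Hyps p)).DeltaTheta),
        (ThetaOrbitData.ofEmbedding ε (MuTwoSetting.inversionModelχ'_compat p)
            (ThetaSetting.modelχ'_sec2Hyps p)).InducesOnTheta (ThetaOrbitData.innerAutTop y) ΓΘ →
        ∀ (hYmap : T.PiYddtp.map (ThetaOrbitData.innerAutTop y).toMulEquiv.toMonoidHom = T.PiYddtp)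
          (hYuu : (T.PiYddtp ⊓ T.tp T.PiXuu).map (ThetaOrbitData.innerAutTop y).toMulEquiv.toMonoidHom =
            T.PiYddtp ⊓ T.tp T.PiXuu),
          (ThetaOrbitData.ofEmbedding ε (MuTwoSetting.inversionModelχ'_compat p) (ThetaSetting.modelχ'_sec2Hyps p)).IsStandardColl
              ((ThetaOrbitData.ofEmbedding ε (MuTwoSetting.inversionModelχ'_compat p) (ThetaSetting.modelχ'_sec2Hyps p)).transport _ (ThetaOrbitData.innerAutTop y) hYmap ΓΘ (ThetaOrbitData.ofEmbedding ε (MuTwoSetting.inversionModelχ'_compat p) (ThetaSetting.modelχ'_sec2Hyps p)).etaZMu2) ∧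
            ((∀ S ∈ T.tower, S.map (ThetaOrbitData.innerAutTop y).toMulEquiv.toMonoidHom = S) →
              (ThetaOrbitData.ofEmbedding ε (MuTwoSetting.inversionModelχ'_compat p) (ThetaSetting.modelχ'_sec2Hyps p)).EqUpToRootOfUnity l _ (ThetaOrbitData.ofEmbedding ε (MuTwoSetting.inversionModelχ'_compat p) (ThetaSetting.modelχ'_sec2Hyps p)).rootLZMu2
                ((ThetaOrbitData.ofEmbedding ε (MuTwoSetting.inversionModelχ'_compat p) (ThetaSetting.modelχ'_sec2Hyps p)).transport _ (ThetaOrbitData.innerAutTop y) hYuu ΓΘ (ThetaOrbitData.ofEmbedding ε (MuTwoSetting.inversionModelχ'_compat p) (ThetaSetting.modelχ'_sec2Hyps p)).rootLZMu2)) ∧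
            ((∀ S ∈ [T.tp T.PiXu, T.tp T.PiX, T.PiYddtp],
                S.map (ThetaOrbitData.innerAutTop y).toMulEquiv.toMonoidHom = S) →
              (ThetaOrbitData.ofEmbedding ε (MuTwoSetting.inversionModelχ'_compat p) (ThetaSetting.modelχ'_sec2Hyps p)).EqUpToRootOfUnity 1 _ (ThetaOrbitData.ofEmbedding ε (MuTwoSetting.inversionModelχ'_compat p) (ThetaSetting.modelχ'_sec2Hyps p)).etaZMu2
                ((ThetaOrbitData.ofEmbedding ε (MuTwoSetting.inversionModelχ'_compat p) (ThetaSetting.modelχ'_sec2Hyps p)).transport _ (ThetaOrbitData.innerAutTop y) hYmap ΓΘ (ThetaOrbitData.ofEmbedding ε (MuTwoSetting.inversionModelχ'_compat p) (ThetaSetting.modelχ'_sec2Hyps p)).etaZMu2)) ∧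
            ((∀ S ∈ [T.tp T.PiCu, T.tp T.PiXu, T.tp T.PiX, T.PiYddtp],
                S.map (ThetaOrbitData.innerAutTop y).toMulEquiv.toMonoidHom = S) →
              (ThetaOrbitData.ofEmbedding ε (MuTwoSetting.inversionModelχ'_compat p) (ThetaSetting.modelχ'_sec2Hyps p)).EqUpToRootOfUnity 1 _ (ThetaOrbitData.ofEmbedding ε (MuTwoSetting.inversionModelχ'_compat p) (ThetaSetting.modelχ'_sec2Hyps p)).etaLZMu2
                ((ThetaOrbitData.ofEmbedding ε (MuTwoSetting.inversionModelχ'_compat p) (ThetaSetting.modelχ'_sec2Hyps p)).transport _ (ThetaOrbitData.innerAutTop y) hYmap ΓΘ (ThetaOrbitData.ofEmbedding ε (MuTwoSetting.inversionModelχ'_compat p) (ThetaSetting.modelχ'_sec2Hyps p)).etaLZMu2)) := by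
  obtain ⟨eX⟩ := nonempty_oncePuncturedData_modelχ' p
  exact ⟨_, _, rfl, rfl, rfl, isStandard_coverOfRecordχ'_tauχ' p hp l hodd eX, fun y ΓΘ hind hYmap hYuu =>
    cor28_i_innerAutTop_endKnit_inversionModelχ' p (cLevelDataInvχ' p) _ _ _ eX hodd _ _ _ _ _ _ rfl
      (doubleUnderlineχ'Sec p l hodd) rfl _ _ _ _ _ (sqrtNegOneUnitχ p hp) (Dpt_tauχ' p hp).le y ΓΘ hind hYmap hYuu⟩


/-- **Binder-free ∃-form for EVERY prime `p`** (every odd `l`): as above with both Def-1.9 slots of the orbit embedding filled by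
abc-iut-w5-d118's anchored point `anchoredPointχ′OfUnit (1+p)` (`Ü = 1 + p`; HONEST LABEL: a slot filling, not the Def. 1.9 pair).
[cite: MochizukiEtTh2009, Cor 2.8(i) p.42] -/
theorem exists_orbitEmbedding_isStandard_cor28_i_innerAutTop_inversionModelχ'_all (l : ℕ+) (hodd : Odd ((l : ℕ+) : ℕ)) :
    ∃ (T : TemperedCoverData.{0} l) (ε : (doubleUnderlineχ'Sec p l hodd).OrbitEmbedding T),
      T.Gtp = (MuTwoSetting.inversionModelχ' p).GtpC ∧
      ε.tau = (anchoredPointχ'OfUnit p (onePlusP p) (onePlusP_ne_cusp p)).toNonCuspidalPoint ∧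
      (ThetaOrbitData.ofEmbedding ε (MuTwoSetting.inversionModelχ'_compat p) (ThetaSetting.modelχ'_sec2Hyps p)).IsStandard ∧
      ∀ (y : T.Gtp)
        (ΓΘ : (ThetaOrbitData.ofEmbedding ε (MuTwoSetting.inversionModelχ'_compat p)
            (ThetaSetting.modelχ'_sec2Hyps p)).DeltaTheta ≃*
          (ThetaOrbitData.ofEmbedding ε (MuTwoSetting.inversionModelχ'_compat p) (ThetaSetting.modelχ'_sec2Hyps p)).DeltaTheta),
        (ThetaOrbitData.ofEmbedding ε (MuTwoSetting.inversionModelχ'_compat p)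
            (ThetaSetting.modelχ'_sec2Hyps p)).InducesOnTheta (ThetaOrbitData.innerAutTop y) ΓΘ →
        ∀ (hYmap : T.PiYddtp.map (ThetaOrbitData.innerAutTop y).toMulEquiv.toMonoidHom = T.PiYddtp)
          (hYuu : (T.PiYddtp ⊓ T.tp T.PiXuu).map (ThetaOrbitData.innerAutTop y).toMulEquiv.toMonoidHom =
            T.PiYddtp ⊓ T.tp T.PiXuu),
          (ThetaOrbitData.ofEmbedding ε (MuTwoSetting.inversionModelχ'_compat p) (ThetaSetting.modelχ'_sec2Hyps p)).IsStandardColl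
              ((ThetaOrbitData.ofEmbedding ε (MuTwoSetting.inversionModelχ'_compat p) (ThetaSetting.modelχ'_sec2Hyps p)).transport _ (ThetaOrbitData.innerAutTop y) hYmap ΓΘ (ThetaOrbitData.ofEmbedding ε (MuTwoSetting.inversionModelχ'_compat p) (ThetaSetting.modelχ'_sec2Hyps p)).etaZMu2) ∧
            ((∀ S ∈ T.tower, S.map (ThetaOrbitData.innerAutTop y).toMulEquiv.toMonoidHom = S) →
              (ThetaOrbitData.ofEmbedding ε (MuTwoSetting.inversionModelχ'_compat p) (ThetaSetting.modelχ'_sec2Hyps p)).EqUpToRootOfUnity l _ (ThetaOrbitData.ofEmbedding ε (MuTwoSetting.inversionModelχ'_compat p) (ThetaSetting.modelχ'_sec2Hyps p)).rootLZMu2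
                ((ThetaOrbitData.ofEmbedding ε (MuTwoSetting.inversionModelχ'_compat p) (ThetaSetting.modelχ'_sec2Hyps p)).transport _ (ThetaOrbitData.innerAutTop y) hYuu ΓΘ (ThetaOrbitData.ofEmbedding ε (MuTwoSetting.inversionModelχ'_compat p) (ThetaSetting.modelχ'_sec2Hyps p)).rootLZMu2)) ∧
            ((∀ S ∈ [T.tp T.PiXu, T.tp T.PiX, T.PiYddtp],
                S.map (ThetaOrbitData.innerAutTop y).toMulEquiv.toMonoidHom = S) →
              (ThetaOrbitData.ofEmbedding ε (MuTwoSetting.inversionModelχ'_compat p) (ThetaSetting.modelχ'_sec2Hyps p)).EqUpToRootOfUnity 1 _ (ThetaOrbitData.ofEmbedding ε (MuTwoSetting.inversionModelχ'_compat p) (ThetaSetting.modelχ'_sec2Hyps p)).etaZMu2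
                ((ThetaOrbitData.ofEmbedding ε (MuTwoSetting.inversionModelχ'_compat p) (ThetaSetting.modelχ'_sec2Hyps p)).transport _ (ThetaOrbitData.innerAutTop y) hYmap ΓΘ (ThetaOrbitData.ofEmbedding ε (MuTwoSetting.inversionModelχ'_compat p) (ThetaSetting.modelχ'_sec2Hyps p)).etaZMu2)) ∧
            ((∀ S ∈ [T.tp T.PiCu, T.tp T.PiXu, T.tp T.PiX, T.PiYddtp],
                S.map (ThetaOrbitData.innerAutTop y).toMulEquiv.toMonoidHom = S) →
              (ThetaOrbitData.ofEmbedding ε (MuTwoSetting.inversionModelχ'_compat p) (ThetaSetting.modelχ'_sec2Hyps p)).EqUpToRootOfUnity 1 _ (ThetaOrbitData.ofEmbedding ε (MuTwoSetting.inversionModelχ'_compat p) (ThetaSetting.modelχ'_sec2Hyps p)).etaLZMu2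
                ((ThetaOrbitData.ofEmbedding ε (MuTwoSetting.inversionModelχ'_compat p) (ThetaSetting.modelχ'_sec2Hyps p)).transport _ (ThetaOrbitData.innerAutTop y) hYmap ΓΘ (ThetaOrbitData.ofEmbedding ε (MuTwoSetting.inversionModelχ'_compat p) (ThetaSetting.modelχ'_sec2Hyps p)).etaLZMu2)) := by
  obtain ⟨eX⟩ := nonempty_oncePuncturedData_modelχ' p
  exact ⟨_, _, rfl, rfl, isStandard_coverOfRecordχ'_anchoredPointχ'OfUnit p l hodd eX, fun y ΓΘ hind hYmap hYuu =>
    cor28_i_innerAutTop_endKnit_inversionModelχ' p (cLevelDataInvχ' p) _ _ _ eX hodd _ _ _ _ _ _ rfl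
      (doubleUnderlineχ'Sec p l hodd) rfl _ _ _ _ _ (onePlusP p) (Dpt_anchoredPointχ'OfUnit p _ _).le y ΓΘ hind hYmap hYuu⟩

end SettingModel

end Literature.AnabelianGeometry.EtaleTheta

end
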